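import Summits.AtomisticToContinuum.FouriersLaw.Theorems.OddSectorIrreversibilityOddCorrectorDecayBathReduction
import Literature.Probability.Process.BrownianDyadicVariation

/-!
# Transport of expectations for the bath-locality estimate: stationarity, Liouville, Brownian moments

Support file for item `stmt-AtomisticToContinuum-9139` (`OddSectorIrreversibility.OddCorrectorDecay`), negative
side. The pathwise comparison of the open chain `z_t = Φ_t(x, B(ω))` (`OscillatorChain.solMap`, both baths at
`T`) with the closed chain `y_t = φ_t(x)` is integrated against the product `ν = μ_T ⊗ P` of the Gibbs weight
`μ_T = e^{-H/T} dq dp` (`OddSectorLocality.gibbsWeight`) and the law `P = wienerPair` of the driving Brownian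
pair. This file supplies the three transport rules that turn `ν`-expectations of the pathwise bound into
STATIC Gibbs integrals, all as Lebesgue integrals of measurable `g ≥ 0` (no integrability side conditions):
* `lintegral_prod_solMap_eq` — STATIONARITY: `∫ g(z_s) dν = ∫ g dμ_T` (`s ≥ 0`), from the kernel Gibbs
  invariance `μ_T P_s = μ_T` (`OddCorrectorBathLocality.lintegral_transitionKernel_gibbsWeight`) and the
  identification of `P_s(x,·)` with the law of `Φ_s(x, B)` (`pinnedChain_lintegral_transitionKernel`);
* `lintegral_prod_closedFlow_eq` — LIOUVILLE: `∫ g(y_s) dν = ∫ g dμ_T`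
  (`ClosedChainFlow.measurePreserving_closedChainFlow_gibbsWeight`);
* `lintegral_prod_abs_brownian_pow_six_le_fst/snd` — BATH NOISE: `∫ |B^k_u|⁶ dν ≤ 1440 e^{u/2} μ_T(univ)`
  (`|b|⁶ ≤ 6!(e^b + e^{-b})` and the Gaussian exponential moment `E e^{±B_u} = e^{u/2}`);
together with the joint measurability of `(s, x, ω) ↦ z_s`, `(s, x) ↦ y_s`, `(u, ω) ↦ B_u` used for Tonelli.
-/

noncomputable section

open MeasureTheory ProbabilityTheory Filter Topology Set Function
open scoped NNReal ENNReal
open Literature.Probability.Process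
open Literature.MathematicalPhysics.KineticTheory Literature.MathematicalPhysics.KineticTheory.HeatConduction
open Literature.MathematicalPhysics.KineticTheory.OddSectorLocality
open Summit.AtomisticToContinuum.FouriersLaw.Theorems.ClosedChainFlow

namespace Summit.AtomisticToContinuum.FouriersLaw.Theorems.OddCorrectorBathLocality

/-! ### Brownian sixth moments -/

section Brownian

/-- `|b|⁶ ≤ 720 (e^{b} + e^{-b})` (`|b|⁶/6! ≤ e^{|b|}`). [folklore] -/
theorem abs_pow_six_le_exp_add (b : ℝ) : |b| ^ 6 ≤ 720 * (Real.exp (1 * b) + Real.exp (-1 * b)) := by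
  have h1 := Real.pow_div_factorial_le_exp (|b|) (abs_nonneg b) 6
  have h720 : ((Nat.factorial 6 : ℕ) : ℝ) = 720 := by norm_num [Nat.factorial]
  rw [h720, div_le_iff₀ (by norm_num : (0:ℝ) < 720)] at h1
  have h2 : Real.exp |b| ≤ Real.exp (1 * b) + Real.exp (-1 * b) := by
    rw [one_mul, neg_one_mul]
    rcases le_total 0 b with hb | hb
    · rw [abs_of_nonneg hb]; linarith [Real.exp_pos (-b)]
    · rw [abs_of_nonpos hb]; linarith [Real.exp_pos b]
  nlinarith

/-- **`E |B_u|⁶ ≤ 1440 e^{u/2}`** for the canonical Brownian motion (crude: via `E e^{±B_u} = e^{u/2}`). [folklore] -/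
theorem lintegral_abs_brownian_pow_six_le (u : ℝ≥0) :
    ∫⁻ ω, ENNReal.ofReal (|brownian u ω| ^ 6) ∂preWienerMeasure ≤ ENNReal.ofReal (1440 * Real.exp (u / 2)) := by
  have hi1 := integrable_exp_mul_brownian u 1
  have hi2 := integrable_exp_mul_brownian u (-1)
  have hint : Integrable (fun ω => 720 * (Real.exp (1 * brownian u ω) + Real.exp (-1 * brownian u ω)))
      preWienerMeasure := (hi1.add hi2).const_mul 720
  calc ∫⁻ ω, ENNReal.ofReal (|brownian u ω| ^ 6) ∂preWienerMeasure
      ≤ ∫⁻ ω, ENNReal.ofReal (720 * (Real.exp (1 * brownian u ω) + Real.exp (-1 * brownian u ω))) ∂preWienerMeasure :=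
        lintegral_mono fun ω => ENNReal.ofReal_le_ofReal (abs_pow_six_le_exp_add _)
    _ = ENNReal.ofReal (∫ ω, 720 * (Real.exp (1 * brownian u ω) + Real.exp (-1 * brownian u ω)) ∂preWienerMeasure) :=
        (ofReal_integral_eq_lintegral_ofReal hint (ae_of_all _ fun ω => by positivity)).symm
    _ = ENNReal.ofReal (1440 * Real.exp (u / 2)) := by
        rw [integral_const_mul, integral_add hi1 hi2, integral_exp_mul_brownian, integral_exp_mul_brownian]
        congr 1
        ring_nf

/-- The pair version, first bath: `∫ |B¹_u|⁶ dP ≤ 1440 e^{u/2}` under `wienerPair`. [folklore] -/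
theorem lintegral_abs_brownian_fst_pow_six_le (u : ℝ≥0) :
    ∫⁻ ω : WienerPair, ENNReal.ofReal (|brownian u ω.1| ^ 6) ∂wienerPair ≤ ENNReal.ofReal (1440 * Real.exp (u / 2)) := by
  haveI := Literature.Probability.RandomPlanarGeometry.isProbabilityMeasure_preWienerMeasure'
  have hm : Measurable fun b : ℝ≥0 → ℝ => ENNReal.ofReal (|brownian u b| ^ 6) := by
    have := measurable_brownian u; fun_prop
  have h : ∫⁻ ω : WienerPair, ENNReal.ofReal (|brownian u ω.1| ^ 6) ∂wienerPair =
      ∫⁻ b, ENNReal.ofReal (|brownian u b| ^ 6) ∂preWienerMeasure := by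
    rw [← lintegral_map hm measurable_fst]
    unfold wienerPair
    rw [Measure.map_fst_prod, measure_univ, one_smul]
  rw [h]
  exact lintegral_abs_brownian_pow_six_le u

/-- The pair version, second bath: `∫ |B²_u|⁶ dP ≤ 1440 e^{u/2}` under `wienerPair`. [folklore] -/
theorem lintegral_abs_brownian_snd_pow_six_le (u : ℝ≥0) :
    ∫⁻ ω : WienerPair, ENNReal.ofReal (|brownian u ω.2| ^ 6) ∂wienerPair ≤ ENNReal.ofReal (1440 * Real.exp (u / 2)) := by
  haveI := Literature.Probability.RandomPlanarGeometry.isProbabilityMeasure_preWienerMeasure'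
  have hm : Measurable fun b : ℝ≥0 → ℝ => ENNReal.ofReal (|brownian u b| ^ 6) := by
    have := measurable_brownian u; fun_prop
  have h : ∫⁻ ω : WienerPair, ENNReal.ofReal (|brownian u ω.2| ^ 6) ∂wienerPair =
      ∫⁻ b, ENNReal.ofReal (|brownian u b| ^ 6) ∂preWienerMeasure := by
    rw [← lintegral_map hm measurable_snd]
    unfold wienerPair
    rw [Measure.map_snd_prod, measure_univ, one_smul]
  rw [h]
  exact lintegral_abs_brownian_pow_six_le u

/-- The canonical Brownian motion read at real times (`t ↦ B_{t⁺}`) is jointly measurable in `(t, ω)`.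
[folklore] -/
theorem measurable_brownian_toNNReal_uncurry :
    Measurable fun q : ℝ × (ℝ≥0 → ℝ) => brownian q.1.toNNReal q.2 := by
  have h : Measurable (uncurry brownian) :=
    measurable_uncurry_of_continuous_of_measurable continuous_brownian fun t => measurable_brownian t
  exact h.comp (measurable_real_toNNReal.comp measurable_fst |>.prodMk measurable_snd)

end Brownian

/-! ### Stationarity and Liouville on the product space -/

section Transport

variable {ω₂ lam β γ : ℝ} (hω : 0 < ω₂) (hl : 0 ≤ lam) (hβ : 0 ≤ β) (hγ : 0 ≤ γ) {N : ℕ} (hN : 0 < N)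
  {T : ℝ} (hT : 0 < T)
include hω hl hβ hγ

/-- The Brownian-driven solution map is jointly measurable in `(s, x, ω)`. [folklore] -/
theorem measurable_solMap_pairPath_uncurry (T_L T_R : ℝ) :
    Measurable fun q : ℝ × (PhaseSpace N × WienerPair) =>
      (pinnedChain ω₂ lam β γ).solMap N T_L T_R q.1 q.2.1 (pairPath q.2.2) := by
  have h2 : Measurable fun q : ℝ × (PhaseSpace N × WienerPair) => (q.1, (q.2.1, pairPath q.2.2)) :=
    measurable_fst.prodMk ((measurable_fst.comp measurable_snd).prodMk
      (measurable_pairPath.comp (measurable_snd.comp measurable_snd)))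
  have h := (pinnedChain_measurable_uncurry_solMap hω hl hβ hγ N T_L T_R).comp h2
  exact h

omit hγ in
/-- The closed flow is jointly measurable in `(s, x)`. [folklore] -/
theorem measurable_closedFlow_uncurry :
    Measurable fun q : ℝ × PhaseSpace N => (pinnedChain ω₂ lam β 0).chainFlow N q.2 0 q.1 := by
  have h0 : Continuous (0 : ℝ → Fin N → ℝ) := continuous_const
  have h := measurable_uncurry_of_continuous_of_measurable
    (u := fun (s : ℝ) (x : PhaseSpace N) => (pinnedChain ω₂ lam β 0).chainFlow N x 0 s)
    (fun x => pinnedChain_continuous_chainFlow hω hl hβ le_rfl N x h0)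
    (fun s => (pinnedChain_continuous_chainFlow_left hω hl hβ le_rfl N h0 s).measurable)
  exact h

include hN hT

/-- **Stationarity on the product space**: for measurable `g ≥ 0` and `s ≥ 0`,
`∫ g(Φ_s(x, B(ω))) d(μ_T ⊗ P)(x, ω) = ∫ g dμ_T`. [folklore] -/
theorem lintegral_prod_solMap_eq {s : ℝ} (hs : 0 ≤ s) {g : PhaseSpace N → ℝ≥0∞} (hg : Measurable g) :
    ∫⁻ p, g ((pinnedChain ω₂ lam β γ).solMap N T T s p.1 (pairPath p.2))
        ∂((gibbsWeight ω₂ lam β γ T N).prod wienerPair) =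
      ∫⁻ x, g x ∂(gibbsWeight ω₂ lam β γ T N) := by
  haveI : SFinite (gibbsWeight ω₂ lam β γ T N) := by unfold gibbsWeight; infer_instance
  have hmeas : Measurable fun p : PhaseSpace N × WienerPair =>
      g ((pinnedChain ω₂ lam β γ).solMap N T T s p.1 (pairPath p.2)) :=
    hg.comp (pinnedChain_measurable_solMap_pairPath hω hl hβ hγ N T T s)
  rw [lintegral_prod _ hmeas.aemeasurable]
  have hs' : ((s.toNNReal : ℝ≥0) : ℝ) = s := Real.coe_toNNReal s hs
  have inner : ∀ x : PhaseSpace N,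
      ∫⁻ ω, g ((pinnedChain ω₂ lam β γ).solMap N T T s x (pairPath ω)) ∂wienerPair =
        ∫⁻ y, g y ∂((pinnedChain ω₂ lam β γ).transitionKernel N T T s.toNNReal x) := fun x => by
    rw [pinnedChain_lintegral_transitionKernel hω hl hβ hγ N T T s.toNNReal x hg, hs']
  simp_rw [inner]
  exact lintegral_transitionKernel_gibbsWeight hω hl hβ hγ hN hT s.toNNReal hg

omit hγ hT in
/-- **Liouville on the product space**: for measurable `g ≥ 0` and `s ≥ 0`,
`∫ g(φ_s x) d(μ_T ⊗ P)(x, ω) = ∫ g dμ_T`. [folklore] -/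
theorem lintegral_prod_closedFlow_eq (γ T : ℝ) {s : ℝ} (hs : 0 ≤ s) {g : PhaseSpace N → ℝ≥0∞} (hg : Measurable g) :
    ∫⁻ p, g ((pinnedChain ω₂ lam β 0).chainFlow N p.1 0 s) ∂((gibbsWeight ω₂ lam β γ T N).prod wienerPair) =
      ∫⁻ x, g x ∂(gibbsWeight ω₂ lam β γ T N) := by
  haveI : SFinite (gibbsWeight ω₂ lam β γ T N) := by unfold gibbsWeight; infer_instance
  have h0 : Continuous (0 : ℝ → Fin N → ℝ) := continuous_const
  have hφm : Measurable fun x : PhaseSpace N => (pinnedChain ω₂ lam β 0).chainFlow N x 0 s :=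
    (pinnedChain_continuous_chainFlow_left hω hl hβ le_rfl N h0 s).measurable
  have hmeas : Measurable fun p : PhaseSpace N × WienerPair => g ((pinnedChain ω₂ lam β 0).chainFlow N p.1 0 s) :=
    (hg.comp hφm).comp measurable_fst
  rw [lintegral_prod _ hmeas.aemeasurable]
  simp only [lintegral_const, measure_univ, mul_one]
  exact (measurePreserving_closedChainFlow_gibbsWeight hω hl hβ hN γ T hs).lintegral_comp hg

omit hω hl hβ hγ hN hT in
/-- **Bath noise on the product space, first bath**: `∫ |B¹_{u}|⁶ d(μ_T ⊗ P) ≤ 1440 e^{u/2} μ_T(univ)`. [folklore] -/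
theorem lintegral_prod_abs_brownian_fst_pow_six_le (T : ℝ) (u : ℝ≥0) :
    ∫⁻ p, ENNReal.ofReal (|brownian u p.2.1| ^ 6) ∂((gibbsWeight ω₂ lam β γ T N).prod wienerPair) ≤
      ENNReal.ofReal (1440 * Real.exp (u / 2)) * gibbsWeight ω₂ lam β γ T N univ := by
  haveI : SFinite (gibbsWeight ω₂ lam β γ T N) := by unfold gibbsWeight; infer_instance
  have hm : Measurable fun p : PhaseSpace N × WienerPair => ENNReal.ofReal (|brownian u p.2.1| ^ 6) := by
    have := measurable_brownian u; fun_prop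
  rw [lintegral_prod _ hm.aemeasurable]
  calc ∫⁻ _x : PhaseSpace N, ∫⁻ ω : WienerPair, ENNReal.ofReal (|brownian u ω.1| ^ 6) ∂wienerPair
        ∂(gibbsWeight ω₂ lam β γ T N)
      = (∫⁻ ω : WienerPair, ENNReal.ofReal (|brownian u ω.1| ^ 6) ∂wienerPair) * gibbsWeight ω₂ lam β γ T N univ :=
        lintegral_const _
    _ ≤ _ := mul_le_mul_left (lintegral_abs_brownian_fst_pow_six_le u) _

omit hω hl hβ hγ hN hT in
/-- **Bath noise on the product space, second bath**: `∫ |B²_{u}|⁶ d(μ_T ⊗ P) ≤ 1440 e^{u/2} μ_T(univ)`. [folklore] -/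
theorem lintegral_prod_abs_brownian_snd_pow_six_le (T : ℝ) (u : ℝ≥0) :
    ∫⁻ p, ENNReal.ofReal (|brownian u p.2.2| ^ 6) ∂((gibbsWeight ω₂ lam β γ T N).prod wienerPair) ≤
      ENNReal.ofReal (1440 * Real.exp (u / 2)) * gibbsWeight ω₂ lam β γ T N univ := by
  haveI : SFinite (gibbsWeight ω₂ lam β γ T N) := by unfold gibbsWeight; infer_instance
  have hm : Measurable fun p : PhaseSpace N × WienerPair => ENNReal.ofReal (|brownian u p.2.2| ^ 6) := by
    have := measurable_brownian u; fun_prop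
  rw [lintegral_prod _ hm.aemeasurable]
  calc ∫⁻ _x : PhaseSpace N, ∫⁻ ω : WienerPair, ENNReal.ofReal (|brownian u ω.2| ^ 6) ∂wienerPair
        ∂(gibbsWeight ω₂ lam β γ T N)
      = (∫⁻ ω : WienerPair, ENNReal.ofReal (|brownian u ω.2| ^ 6) ∂wienerPair) * gibbsWeight ω₂ lam β γ T N univ :=
        lintegral_const _
    _ ≤ _ := mul_le_mul_left (lintegral_abs_brownian_snd_pow_six_le u) _

end Transport

end Summit.AtomisticToContinuum.FouriersLaw.Theorems.OddCorrectorBathLocality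

end
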